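import Literature.Analysis.FunctionSpaces.ItoProcessesProofs
import HarnessLib

/-!
# An everywhere-continuous adapted version of the clock `∫₀ᵗ J_s ds` of a progressive integrand

Topic `Probability/Process`; generic (any filtration of the raw kind, no usual conditions);
definitions with proved API, no named fact.

Motivation ([LSW] §8.3–8.4). The driving function of SLE(κ, ρ) is
`W_t = √κ B_t + ρ ∫₀ᵗ J_s ds` with `J = 1/Z ≥ 0` progressively measurable and ALMOST SURELY
locally integrable (Lawler–Schramm–Werner (2003), §8.3: "`∫₀ᵗ du/Z_u = (Z_t − √κ B_t)/(ρ+2) < ∞`").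
The localisation of the one-sided martingale of [LSW] Lemma 8.9 by hitting times requires
processes whose paths are continuous for EVERY sample point (hitting times of closed sets by
continuous adapted processes are stopping times of the raw filtration,
`Literature.Probability.Process.isStoppingTime_hittingAfter_of_continuous`), whereas the
pathwise time integral `timeIntegral J t ω = ∫₀ᵗ J_s(ω) ds` (Bochner, junk value `0` where the
path is not integrable) is continuous in `t` only on the paths where `J(ω)` is locally
integrable. This file constructs a version with the required regularity on ALL paths:

* `rawClock J t ω = ∫⁻_{(0,t]} J_s(ω) ds ∈ [0, ∞]` (lower Lebesgue integral) — progressively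
  measurable (`isStronglyProgressive_rawClock`), non-decreasing in `t`;
* `flat J` — the integrand `J` switched off from the first time the raw clock is infinite
  (`J_s 𝟙{rawClock J s < ∞}`), progressive (`isStronglyProgressive_flat`);
* `clock J = rawClock (flat J)` — **non-decreasing and CONTINUOUS in `t ∈ ℝ≥0` (with values in
  `[0, ∞]`) for every `ω`** (`continuous_clock`: left-continuity by monotone convergence;
  right-continuity because either the clock is finite slightly later, or the raw clock is
  infinite at all later times and then the flattened integrand vanishes there), progressive and
  adapted; it agrees with `rawClock J`, and `(clock J t ω).toReal` with `timeIntegral J t ω`, on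
  every path on which `J(ω) ≥ 0` is locally integrable (`clock_eq_rawClock`,
  `toReal_clock_eq_timeIntegral`);
* `clockTrunc J c t ω = (min (clock J t ω) c).toReal ∈ [0, c]` — the clock truncated at level
  `c`: a real process, adapted, with continuous non-decreasing paths for every `ω`
  (`continuous_clockTrunc`), equal to `timeIntegral J t ω` as long as the latter is `≤ c` on a
  locally integrable path (`clockTrunc_eq_timeIntegral`).

With `W^c = √κ B + ρ · clockTrunc J c` one obtains driving processes with everywhere continuous
paths, adapted to the raw Brownian filtration, that agree with the SLE(κ, ρ) driving function up
to the stopping time at which the clock reaches `c` (used for [LSW] Lemma 8.9 downstream).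

## References

* G. F. Lawler, O. Schramm, W. Werner, *Conformal restriction: the chordal case*, J. Amer. Math.
  Soc. 16 (2003), §8.3 (definition of SLE(κ, ρ)). [LawlerSchrammWerner2003Restriction]
* D. Revuz, M. Yor, *Continuous Martingales and Brownian Motion* (1999), Ch. I §4
  (progressive measurability), Ch. IV §1.
-/

noncomputable section

open MeasureTheory Filter Topology Set
open scoped NNReal ENNReal
open Literature.Analysis.FunctionSpaces (timeIntegral)

namespace Literature.Probability.Process

variable {Ω : Type*} {m : MeasurableSpace Ω} {𝓕 : Filtration ℝ≥0 m} {J : ℝ≥0 → Ω → ℝ}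

/-! ### The raw clock `∫⁻_{(0,t]} J` -/

/-- **The raw clock** `∫⁻_{(0,t]} J_s(ω) ds ∈ [0, ∞]` of a real integrand `J` (lower Lebesgue
integral of `ENNReal.ofReal ∘ J` along the path, time variable read through `Real.toNNReal` as in
`timeIntegral`). [folklore] -/
def rawClock (J : ℝ≥0 → Ω → ℝ) (t : ℝ≥0) (ω : Ω) : ℝ≥0∞ :=
  ∫⁻ s in Ioc (0 : ℝ) t, ENNReal.ofReal (J s.toNNReal ω)

/-- The raw clock is non-decreasing in time. [folklore] -/
theorem monotone_rawClock (J : ℝ≥0 → Ω → ℝ) (ω : Ω) : Monotone fun t ↦ rawClock J t ω :=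
  fun _ _ hst ↦ lintegral_mono_set (Ioc_subset_Ioc_right (by exact_mod_cast hst))

/-- The raw clock vanishes at time `0`. [folklore] -/
@[simp] theorem rawClock_zero (J : ℝ≥0 → Ω → ℝ) (ω : Ω) : rawClock J 0 ω = 0 := by
  simp [rawClock]

/-- Additivity of the raw clock over consecutive intervals. [folklore] -/
theorem rawClock_eq_add {s t : ℝ≥0} (hst : s ≤ t) (ω : Ω) :
    rawClock J t ω = rawClock J s ω + ∫⁻ r in Ioc (s : ℝ) t, ENNReal.ofReal (J r.toNNReal ω) := by
  rw [rawClock, rawClock, ← Ioc_union_Ioc_eq_Ioc s.coe_nonneg (by exact_mod_cast hst),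
    lintegral_union measurableSet_Ioc (Ioc_disjoint_Ioc_of_le le_rfl)]

/-- **The raw clock of a progressive integrand is progressive** (as an `[0, ∞]`-valued process):
Fubini measurability of the parametric lower integral on `Set.Iic i × Ω` with the σ-algebra
`𝓑 ⊗ 𝓕 i`. [folklore] -/
theorem isStronglyProgressive_rawClock (hJ : IsStronglyProgressive 𝓕 J) :
    IsStronglyProgressive 𝓕 (rawClock J) := by
  intro i
  letI mΩ : MeasurableSpace Ω := 𝓕 i
  have hgi : Measurable (fun p : Set.Iic i × Ω ↦ J p.1 p.2) := (hJ i).measurable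
  have hG : Measurable (fun q : (Set.Iic i × Ω) × ℝ ↦
      ENNReal.ofReal (J (min q.2.toNNReal i) q.1.2)) := by
    have h1 : Measurable (fun q : (Set.Iic i × Ω) × ℝ ↦
        ((⟨min q.2.toNNReal i, Set.mem_Iic.2 (min_le_right _ _)⟩, q.1.2) : Set.Iic i × Ω)) :=
      ((measurable_real_toNNReal.comp measurable_snd).min measurable_const).subtype_mk.prodMk
        (measurable_snd.comp measurable_fst)
    exact ENNReal.measurable_ofReal.comp (hgi.comp h1)
  have hS : MeasurableSet {q : (Set.Iic i × Ω) × ℝ | q.2 ∈ Set.Ioc (0 : ℝ) q.1.1} := by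
    have h1 : Measurable (fun q : (Set.Iic i × Ω) × ℝ ↦ q.2) := measurable_snd
    have h2 : Measurable (fun q : (Set.Iic i × Ω) × ℝ ↦ ((q.1.1 : ℝ≥0) : ℝ)) :=
      (measurable_coe_nnreal_real.comp measurable_subtype_coe).comp (measurable_fst.comp measurable_fst)
    exact (measurableSet_lt measurable_const h1).inter (measurableSet_le h1 h2)
  have hF : Measurable (fun q : (Set.Iic i × Ω) × ℝ ↦
      {q : (Set.Iic i × Ω) × ℝ | q.2 ∈ Set.Ioc (0 : ℝ) q.1.1}.indicator
        (fun q ↦ ENNReal.ofReal (J (min q.2.toNNReal i) q.1.2)) q) := hG.indicator hS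
  have hint : Measurable fun p : Set.Iic i × Ω ↦ ∫⁻ s,
      {q : (Set.Iic i × Ω) × ℝ | q.2 ∈ Set.Ioc (0 : ℝ) q.1.1}.indicator
        (fun q ↦ ENNReal.ofReal (J (min q.2.toNNReal i) q.1.2)) (p, s) :=
    hF.lintegral_prod_right'
  have heq : (fun p : Set.Iic i × Ω ↦ rawClock J p.1 p.2) = fun p ↦ ∫⁻ s,
      {q : (Set.Iic i × Ω) × ℝ | q.2 ∈ Set.Ioc (0 : ℝ) q.1.1}.indicator
        (fun q ↦ ENNReal.ofReal (J (min q.2.toNNReal i) q.1.2)) (p, s) := by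
    funext p
    rw [rawClock, ← lintegral_indicator measurableSet_Ioc]
    congr 1
    funext s
    simp only [Set.indicator_apply, Set.mem_setOf_eq]
    split_ifs with hs
    · rw [min_eq_left ((Real.toNNReal_le_iff_le_coe.2 hs.2).trans p.1.2)]
    · rfl
  rw [heq]
  exact hint.stronglyMeasurable

/-! ### The flattened integrand and the continuous clock -/

open Classical in
/-- **The flattened integrand**: `J` switched off from the first time the raw clock is infinite,
`flat J s ω = J_s(ω) 𝟙{∫⁻_{(0,s]} J(ω) < ∞}`. On a path on which `J(ω) ≥ 0` is locally
integrable it is `J(ω)` itself (`flat_eq_self`). [folklore] -/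
def flat (J : ℝ≥0 → Ω → ℝ) (s : ℝ≥0) (ω : Ω) : ℝ :=
  if rawClock J s ω = ∞ then 0 else J s ω

/-- Unfolding of `flat` where the raw clock is infinite. [folklore] -/
theorem flat_of_eq_top {s : ℝ≥0} {ω : Ω} (h : rawClock J s ω = ∞) : flat J s ω = 0 := by
  classical
  exact if_pos h

/-- Unfolding of `flat` where the raw clock is finite. [folklore] -/
theorem flat_of_ne_top {s : ℝ≥0} {ω : Ω} (h : rawClock J s ω ≠ ∞) : flat J s ω = J s ω := by
  classical
  exact if_neg h

/-- `ENNReal.ofReal (flat J s ω) ≤ ENNReal.ofReal (J s ω)` (no sign condition needed). [folklore] -/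
theorem ofReal_flat_le (s : ℝ≥0) (ω : Ω) : ENNReal.ofReal (flat J s ω) ≤ ENNReal.ofReal (J s ω) := by
  by_cases h : rawClock J s ω = ∞
  · rw [flat_of_eq_top h, ENNReal.ofReal_zero]; exact bot_le
  · rw [flat_of_ne_top h]

/-- The flattened integrand of a progressive integrand is progressive. [folklore] -/
theorem isStronglyProgressive_flat (hJ : IsStronglyProgressive 𝓕 J) :
    IsStronglyProgressive 𝓕 (flat J) := by
  classical
  intro i
  letI mΩ : MeasurableSpace Ω := 𝓕 i
  have hgi : Measurable (fun p : Set.Iic i × Ω ↦ J p.1 p.2) := (hJ i).measurable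
  have hraw : Measurable (fun p : Set.Iic i × Ω ↦ rawClock J p.1 p.2) :=
    (isStronglyProgressive_rawClock hJ i).measurable
  have hset : MeasurableSet {p : Set.Iic i × Ω | rawClock J p.1 p.2 = ∞} :=
    hraw (measurableSet_singleton ∞)
  have heq : (fun p : Set.Iic i × Ω ↦ flat J p.1 p.2) =
      fun p ↦ if p ∈ {p : Set.Iic i × Ω | rawClock J p.1 p.2 = ∞} then (0 : ℝ) else J p.1 p.2 := by
    funext p; rfl
  rw [heq]
  exact (Measurable.ite hset measurable_const hgi).stronglyMeasurable

/-- **The continuous clock** `clock J = ∫⁻_{(0,t]} flat J`: the raw clock of the flattened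
integrand. It is `∫₀ᵗ J` on every path on which `J(ω) ≥ 0` is locally integrable
(`toReal_clock_eq_timeIntegral`), and it has continuous non-decreasing `[0, ∞]`-valued paths for
EVERY `ω` (`continuous_clock`). [folklore] -/
def clock (J : ℝ≥0 → Ω → ℝ) : ℝ≥0 → Ω → ℝ≥0∞ := rawClock (flat J)

/-- The clock is progressive. [folklore] -/
theorem isStronglyProgressive_clock (hJ : IsStronglyProgressive 𝓕 J) :
    IsStronglyProgressive 𝓕 (clock J) :=
  isStronglyProgressive_rawClock (isStronglyProgressive_flat hJ)

/-- The clock is adapted: `clock J t` is `𝓕 t`-measurable. [folklore] -/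
theorem measurable_clock (hJ : IsStronglyProgressive 𝓕 J) (t : ℝ≥0) :
    Measurable[𝓕 t] (clock J t) :=
  ((isStronglyProgressive_clock hJ).stronglyAdapted t).measurable

/-- The clock is non-decreasing in time. [folklore] -/
theorem monotone_clock (J : ℝ≥0 → Ω → ℝ) (ω : Ω) : Monotone fun t ↦ clock J t ω :=
  monotone_rawClock _ ω

/-- The clock vanishes at time `0`. [folklore] -/
@[simp] theorem clock_zero (J : ℝ≥0 → Ω → ℝ) (ω : Ω) : clock J 0 ω = 0 := rawClock_zero _ ω

/-- The clock is dominated by the raw clock (`flat J ≤ J` inside `ENNReal.ofReal`). [folklore] -/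
theorem clock_le_rawClock (t : ℝ≥0) (ω : Ω) : clock J t ω ≤ rawClock J t ω :=
  lintegral_mono fun s ↦ ofReal_flat_le s.toNNReal ω

/-- If the raw clock is infinite at time `t`, the flattened integrand vanishes at all real times
beyond `t`. [folklore] -/
theorem ofReal_flat_toNNReal_eq_zero {t : ℝ≥0} {ω : Ω} (h : ∀ t' : ℝ≥0, t < t' → rawClock J t' ω = ∞)
    {r : ℝ} (hr : (t : ℝ) < r) : ENNReal.ofReal (flat J r.toNNReal ω) = 0 := by
  have hr' : t < r.toNNReal := by
    rw [← NNReal.coe_lt_coe, Real.coe_toNNReal _ (t.coe_nonneg.trans hr.le)]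
    exact hr
  rw [flat_of_eq_top (h _ hr'), ENNReal.ofReal_zero]

/-- **The clock has continuous paths, for every `ω`** (as a map `ℝ≥0 → [0, ∞]`).
Left-continuity: monotone convergence (`(0, t] = ⋃ₙ (0, sₙ] ∪ {t}`, the singleton being
Lebesgue-null). Right-continuity at `t`: if the clock is finite at some later time, continuity of
the measure `flat J · Leb` from above; otherwise the raw clock is infinite at every later time, so
`flat J` vanishes on `(t, ∞)` and the clock is constant there. [folklore] -/
theorem continuous_clock (J : ℝ≥0 → Ω → ℝ) (ω : Ω) : Continuous fun t ↦ clock J t ω := by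
  -- the clock as the distribution function of the measure `ν = (flat J) · Leb`
  set f : ℝ → ℝ≥0∞ := fun r ↦ ENNReal.ofReal (flat J r.toNNReal ω) with hf
  set ν : Measure ℝ := volume.withDensity f with hν
  have hF : ∀ t : ℝ≥0, clock J t ω = ν (Ioc (0 : ℝ) t) := fun t ↦ by
    rw [hν, withDensity_apply _ measurableSet_Ioc]; rfl
  have hmono : Monotone fun t ↦ clock J t ω := monotone_clock J ω
  have hνac : ν ≪ volume := withDensity_absolutelyContinuous _ _
  refine continuous_iff_continuousAt.2 fun t ↦ continuousAt_iff_continuous_left'_right'.2 ⟨?_, ?_⟩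
  · -- left-continuity at `t`
    rcases eq_or_ne t 0 with rfl | ht0
    · have : Iio (0 : ℝ≥0) = ∅ := by ext x; simp
      rw [ContinuousWithinAt, this, nhdsWithin_empty]
      exact tendsto_bot
    have htpos : (0 : ℝ) < t := by
      have : (0 : ℝ≥0) < t := pos_iff_ne_zero.2 ht0
      exact_mod_cast this
    -- the sequence `sₙ = t (1 - 1/(n+2)) ↑ t`
    set c : ℕ → ℝ := fun n ↦ 1 - 1 / ((n : ℝ) + 2) with hc
    have hc0 : ∀ n, 0 ≤ c n := fun n ↦ by
      rw [hc]; have : (1 : ℝ) / ((n : ℝ) + 2) ≤ 1 := by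
        rw [div_le_one (by positivity)]; linarith [n.cast_nonneg (α := ℝ)]
      linarith
    have hc1 : ∀ n, c n < 1 := fun n ↦ by
      rw [hc]; have : (0 : ℝ) < 1 / ((n : ℝ) + 2) := by positivity
      linarith
    have hcmono : Monotone c := fun a b hab ↦ by
      simp only [hc]
      have : (1 : ℝ) / ((b : ℝ) + 2) ≤ 1 / ((a : ℝ) + 2) :=
        one_div_le_one_div_of_le (by positivity) (by exact_mod_cast Nat.add_le_add_right hab 2)
      linarith
    set sq : ℕ → ℝ≥0 := fun n ↦ ⟨(t : ℝ) * c n, mul_nonneg t.coe_nonneg (hc0 n)⟩ with hsq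
    have hsq_coe : ∀ n, ((sq n : ℝ≥0) : ℝ) = t * c n := fun n ↦ rfl
    have hsq_lt : ∀ n, sq n < t := fun n ↦ by
      rw [← NNReal.coe_lt_coe, hsq_coe]
      calc (t : ℝ) * c n < t * 1 := mul_lt_mul_of_pos_left (hc1 n) htpos
        _ = t := mul_one _
    have hsmono : Monotone fun n ↦ Ioc (0 : ℝ) (sq n) := fun a b hab ↦
      Ioc_subset_Ioc_right (by rw [hsq_coe, hsq_coe]; exact mul_le_mul_of_nonneg_left (hcmono hab) t.coe_nonneg)
    have hU : (⋃ n, Ioc (0 : ℝ) (sq n)) = Ioo (0 : ℝ) t := by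
      ext x
      simp only [mem_iUnion, mem_Ioc, mem_Ioo]
      constructor
      · rintro ⟨n, hx0, hxn⟩
        exact ⟨hx0, hxn.trans_lt (by exact_mod_cast hsq_lt n)⟩
      · rintro ⟨hx0, hxt⟩
        -- choose `n` with `t/(n+2) ≤ t - x`
        obtain ⟨n, hn⟩ := exists_nat_gt ((t : ℝ) / ((t : ℝ) - x))
        refine ⟨n, hx0, ?_⟩
        rw [hsq_coe, hc]
        have htx : 0 < (t : ℝ) - x := by linarith
        have h1 : (t : ℝ) / ((n : ℝ) + 2) ≤ (t : ℝ) - x := by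
          rw [div_le_iff₀ (by positivity)]
          rw [div_lt_iff₀ htx] at hn
          nlinarith
        have : (t : ℝ) * (1 - 1 / ((n : ℝ) + 2)) = t - t / ((n : ℝ) + 2) := by ring
        rw [this]
        linarith
    have hlim : Tendsto (fun n ↦ clock J (sq n) ω) atTop (𝓝 (clock J t ω)) := by
      have h1 := tendsto_measure_iUnion_atTop (μ := ν) hsmono
      rw [hU] at h1
      have h2 : ν (Ioo (0 : ℝ) t) = ν (Ioc (0 : ℝ) t) := by
        rw [← Ioc_sdiff_right, measure_sdiff_null (hνac Real.volume_singleton)]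
      have h3 : (fun n ↦ clock J (sq n) ω) = ν ∘ fun n ↦ Ioc (0 : ℝ) (sq n) := funext fun n ↦ hF _
      rw [h3, hF, ← h2]
      exact h1
    -- monotone functions: convergence along `sₙ ↑ t` gives the left limit
    refine tendsto_order.2 ⟨fun a ha ↦ ?_, fun a ha ↦ ?_⟩
    · obtain ⟨n, hn⟩ := (hlim.eventually (lt_mem_nhds ha)).exists
      filter_upwards [Ioo_mem_nhdsLT (hsq_lt n)] with s hs
      exact hn.trans_le (hmono hs.1.le)
    · filter_upwards [self_mem_nhdsWithin] with s hs
      exact (hmono (le_of_lt hs)).trans_lt ha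
  · -- right-continuity at `t`
    by_cases h : ∃ t' : ℝ≥0, t < t' ∧ clock J t' ω ≠ ∞
    · obtain ⟨t', htt', hfin⟩ := h
      -- the sequence `uₙ = t + (t' - t)/(n+1) ↓ t`
      set u : ℕ → ℝ≥0 := fun n ↦ t + (t' - t) / ((n : ℝ≥0) + 1) with hu
      have hut : ∀ n, t < u n := fun n ↦ by
        rw [hu]; exact lt_add_of_pos_right _ (div_pos (tsub_pos_of_lt htt') (by positivity))
      have hut' : ∀ n, u n ≤ t' := fun n ↦ by
        rw [hu]
        have h1 : (t' - t) / ((n : ℝ≥0) + 1) ≤ t' - t := div_le_self bot_le (by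
          exact_mod_cast Nat.le_add_left 1 n)
        calc t + (t' - t) / ((n : ℝ≥0) + 1) ≤ t + (t' - t) := add_le_add le_rfl h1
          _ = t' := add_tsub_cancel_of_le htt'.le
      have huanti : Antitone fun n ↦ Ioc (0 : ℝ) (u n) := fun a b hab ↦ by
        refine Ioc_subset_Ioc_right ?_
        have hδ : (t' - t) / ((b : ℝ≥0) + 1) ≤ (t' - t) / ((a : ℝ≥0) + 1) :=
          div_le_div_of_nonneg_left bot_le (by positivity) (by exact_mod_cast Nat.add_le_add_right hab 1)
        have : u b ≤ u a := by rw [hu]; exact add_le_add le_rfl hδ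
        exact_mod_cast this
      have hI : (⋂ n, Ioc (0 : ℝ) (u n)) = Ioc (0 : ℝ) t := by
        ext x
        simp only [mem_iInter, mem_Ioc]
        constructor
        · intro hx
          refine ⟨(hx 0).1, le_of_forall_pos_lt_add fun ε hε ↦ ?_⟩
          obtain ⟨n, hn⟩ := exists_nat_gt (((t' : ℝ) - t) / ε)
          have hxn := (hx n).2
          rw [hu] at hxn; push_cast at hxn
          rw [NNReal.coe_sub htt'.le] at hxn
          have hε' : ((t' : ℝ) - t) / ((n : ℝ) + 1) < ε := by
            rw [div_lt_iff₀ (by positivity)]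
            rw [div_lt_iff₀ hε] at hn
            nlinarith
          linarith
        · rintro ⟨hx0, hxt⟩ n
          exact ⟨hx0, hxt.trans (by exact_mod_cast (hut n).le)⟩
      have hlim : Tendsto (fun n ↦ clock J (u n) ω) atTop (𝓝 (clock J t ω)) := by
        have h1 := tendsto_measure_iInter_atTop (μ := ν) (fun n ↦ measurableSet_Ioc.nullMeasurableSet)
          huanti ⟨0, by rw [← hF]; exact ne_top_of_le_ne_top hfin (hmono (hut' 0))⟩
        rw [hI, ← hF] at h1
        have h3 : (fun n ↦ clock J (u n) ω) = ν ∘ fun n ↦ Ioc (0 : ℝ) (u n) := funext fun n ↦ hF _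
        rw [h3]
        exact h1
      refine tendsto_order.2 ⟨fun a ha ↦ ?_, fun a ha ↦ ?_⟩
      · filter_upwards [self_mem_nhdsWithin] with s hs
        exact ha.trans_le (hmono (le_of_lt hs))
      · obtain ⟨n, hn⟩ := (hlim.eventually (gt_mem_nhds ha)).exists
        filter_upwards [Ioo_mem_nhdsGT (hut n)] with s hs
        exact (hmono hs.2.le).trans_lt hn
    · -- the clock is infinite at all later times: it is constant on `(t, ∞)`... and equal to its
      -- value at `t`, because the flattened integrand vanishes beyond `t`
      push Not at h
      have hraw : ∀ t' : ℝ≥0, t < t' → rawClock J t' ω = ∞ := fun t' ht' ↦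
        eq_top_iff.2 ((h t' ht').symm.le.trans (clock_le_rawClock t' ω))
      have hconst : ∀ s : ℝ≥0, t < s → clock J s ω = clock J t ω := by
        intro s hs
        rw [clock, rawClock_eq_add hs.le]
        have hzero : ∫⁻ r in Ioc (t : ℝ) s, ENNReal.ofReal (flat J r.toNNReal ω) = 0 := by
          rw [setLIntegral_congr_fun measurableSet_Ioc
            (fun r hr ↦ ofReal_flat_toNNReal_eq_zero hraw hr.1), lintegral_zero]
        rw [hzero, add_zero]
      refine (tendsto_const_nhds (x := clock J t ω)).congr' ?_
      filter_upwards [self_mem_nhdsWithin] with s hs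
      exact (hconst s hs).symm

/-! ### The truncated clock: a real continuous adapted process -/

/-- **The clock truncated at level `c`**: `(min (clock J t ω) c).toReal ∈ [0, c]`. [folklore] -/
def clockTrunc (J : ℝ≥0 → Ω → ℝ) (c : ℝ≥0) (t : ℝ≥0) (ω : Ω) : ℝ :=
  (min (clock J t ω) c).toReal

/-- Values of the truncated clock lie in `[0, c]`. [folklore] -/
theorem clockTrunc_mem_Icc (c t : ℝ≥0) (ω : Ω) : clockTrunc J c t ω ∈ Icc (0 : ℝ) c := by
  refine ⟨ENNReal.toReal_nonneg, ?_⟩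
  rw [clockTrunc, ← ENNReal.coe_toReal c]
  exact ENNReal.toReal_mono ENNReal.coe_ne_top (min_le_right _ _)

/-- The truncated clock vanishes at time `0`. [folklore] -/
@[simp] theorem clockTrunc_zero (c : ℝ≥0) (ω : Ω) : clockTrunc J c 0 ω = 0 := by
  simp [clockTrunc]

/-- The truncated clock is non-decreasing in time. [folklore] -/
theorem monotone_clockTrunc (c : ℝ≥0) (ω : Ω) : Monotone fun t ↦ clockTrunc J c t ω :=
  fun _ _ hst ↦ ENNReal.toReal_mono (ne_top_of_le_ne_top ENNReal.coe_ne_top (min_le_right _ _))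
    (min_le_min_right _ (monotone_clock J ω hst))

/-- Below the level, the truncated clock is the clock. [folklore] -/
theorem clockTrunc_eq_toReal {c t : ℝ≥0} {ω : Ω} (h : clock J t ω ≤ c) :
    clockTrunc J c t ω = (clock J t ω).toReal := by
  rw [clockTrunc, min_eq_left h]

/-- Two truncation levels agree below the smaller one. [folklore] -/
theorem clockTrunc_eq_clockTrunc {c c' t : ℝ≥0} {ω : Ω} (h : clock J t ω ≤ c) (hcc' : c ≤ c') :
    clockTrunc J c t ω = clockTrunc J c' t ω := by
  rw [clockTrunc_eq_toReal h, clockTrunc_eq_toReal (h.trans (by exact_mod_cast hcc'))]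

/-- **The truncated clock has continuous paths, for every `ω`.** [folklore] -/
theorem continuous_clockTrunc (c : ℝ≥0) (ω : Ω) : Continuous fun t ↦ clockTrunc J c t ω := by
  have h1 : Continuous fun t ↦ min (clock J t ω) c := (continuous_clock J ω).min continuous_const
  exact ENNReal.continuousOn_toReal.comp_continuous h1 fun t ↦
    ne_top_of_le_ne_top ENNReal.coe_ne_top (min_le_right _ _)

/-- **The truncated clock is adapted**: `clockTrunc J c t` is `𝓕 t`-measurable. [folklore] -/
theorem measurable_clockTrunc (hJ : IsStronglyProgressive 𝓕 J) (c t : ℝ≥0) :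
    Measurable[𝓕 t] (clockTrunc J c t) :=
  ((measurable_clock hJ t).min measurable_const).ennreal_toReal

/-- The truncated clock is adapted. [folklore] -/
theorem adapted_clockTrunc (hJ : IsStronglyProgressive 𝓕 J) (c : ℝ≥0) :
    Adapted 𝓕 (clockTrunc J c) := fun t ↦ measurable_clockTrunc hJ c t

/-- The truncated clock is strongly adapted. [folklore] -/
theorem stronglyAdapted_clockTrunc (hJ : IsStronglyProgressive 𝓕 J) (c : ℝ≥0) :
    StronglyAdapted 𝓕 (clockTrunc J c) := fun t ↦ (measurable_clockTrunc hJ c t).stronglyMeasurable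

/-! ### Identification with `timeIntegral` on locally integrable paths -/

section Path

variable {ω : Ω}

/-- On a path on which `J(ω) ≥ 0` is integrable on every `(0, t]`, the raw clock is
`ENNReal.ofReal (timeIntegral J t ω)` (in particular finite). [folklore] -/
theorem rawClock_eq_ofReal_timeIntegral (hJ0 : ∀ s, 0 ≤ J s ω)
    (hint : ∀ t : ℝ≥0, IntegrableOn (fun s : ℝ ↦ J s.toNNReal ω) (Ioc (0 : ℝ) t)) (t : ℝ≥0) :
    rawClock J t ω = ENNReal.ofReal (timeIntegral J t ω) := by
  rw [rawClock, timeIntegral, intervalIntegral.integral_of_le t.coe_nonneg,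
    ofReal_integral_eq_lintegral_ofReal (hint t) (ae_of_all _ fun s ↦ hJ0 _)]

/-- On such a path the flattened integrand is `J` itself. [folklore] -/
theorem flat_eq_self (hJ0 : ∀ s, 0 ≤ J s ω)
    (hint : ∀ t : ℝ≥0, IntegrableOn (fun s : ℝ ↦ J s.toNNReal ω) (Ioc (0 : ℝ) t)) (s : ℝ≥0) :
    flat J s ω = J s ω :=
  flat_of_ne_top (by rw [rawClock_eq_ofReal_timeIntegral hJ0 hint]; exact ENNReal.ofReal_ne_top)

/-- On such a path the clock is the raw clock. [folklore] -/
theorem clock_eq_rawClock (hJ0 : ∀ s, 0 ≤ J s ω)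
    (hint : ∀ t : ℝ≥0, IntegrableOn (fun s : ℝ ↦ J s.toNNReal ω) (Ioc (0 : ℝ) t)) (t : ℝ≥0) :
    clock J t ω = rawClock J t ω := by
  rw [clock, rawClock, rawClock]
  exact lintegral_congr fun s ↦ by rw [flat_eq_self hJ0 hint]

/-- **On a locally integrable path the clock is `∫₀ᵗ J`**: `(clock J t ω).toReal = timeIntegral J t ω`
and the clock is finite. [folklore] -/
theorem toReal_clock_eq_timeIntegral (hJ0 : ∀ s, 0 ≤ J s ω)
    (hint : ∀ t : ℝ≥0, IntegrableOn (fun s : ℝ ↦ J s.toNNReal ω) (Ioc (0 : ℝ) t)) (t : ℝ≥0) :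
    clock J t ω = ENNReal.ofReal (timeIntegral J t ω) ∧ (clock J t ω).toReal = timeIntegral J t ω := by
  have h := clock_eq_rawClock hJ0 hint t
  rw [rawClock_eq_ofReal_timeIntegral hJ0 hint] at h
  refine ⟨h, ?_⟩
  rw [h, ENNReal.toReal_ofReal]
  rw [timeIntegral, intervalIntegral.integral_of_le t.coe_nonneg]
  exact setIntegral_nonneg measurableSet_Ioc fun s _ ↦ hJ0 s.toNNReal

/-- **On a locally integrable path the truncated clock is `∫₀ᵗ J` as long as `∫₀ᵗ J ≤ c`.**
[folklore] -/
theorem clockTrunc_eq_timeIntegral (hJ0 : ∀ s, 0 ≤ J s ω)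
    (hint : ∀ t : ℝ≥0, IntegrableOn (fun s : ℝ ↦ J s.toNNReal ω) (Ioc (0 : ℝ) t)) {c t : ℝ≥0}
    (hle : timeIntegral J t ω ≤ c) : clockTrunc J c t ω = timeIntegral J t ω := by
  obtain ⟨h1, h2⟩ := toReal_clock_eq_timeIntegral hJ0 hint t
  have hle' : clock J t ω ≤ c := by
    rw [h1, ← ENNReal.ofReal_coe_nnreal]
    exact ENNReal.ofReal_le_ofReal hle
  rw [clockTrunc_eq_toReal hle', h2]

/-- Conversely, on a locally integrable path, if the truncated clock is `< c` at time `t` then it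
is `∫₀ᵗ J` there (the clock has not reached the level). [folklore] -/
theorem clockTrunc_eq_timeIntegral_of_lt (hJ0 : ∀ s, 0 ≤ J s ω)
    (hint : ∀ t : ℝ≥0, IntegrableOn (fun s : ℝ ↦ J s.toNNReal ω) (Ioc (0 : ℝ) t)) {c t : ℝ≥0}
    (hlt : clockTrunc J c t ω < c) : clockTrunc J c t ω = timeIntegral J t ω := by
  obtain ⟨h1, h2⟩ := toReal_clock_eq_timeIntegral hJ0 hint t
  have hle' : clock J t ω ≤ c := by
    by_contra hlt'
    push Not at hlt'
    rw [clockTrunc, min_eq_right hlt'.le, ENNReal.coe_toReal] at hlt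
    exact lt_irrefl _ hlt
  rw [clockTrunc_eq_toReal hle', h2]

end Path

end Literature.Probability.Process

end
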